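import Mathlib.GroupTheory.GroupAction.Defs
import Mathlib.GroupTheory.GroupAction.Basic
import Mathlib.Algebra.Group.End
import Mathlib.SetTheory.Cardinal.Finite
import Mathlib.Data.Fintype.Prod
import Mathlib.Logic.Equiv.Fintype
import Mathlib.Tactic.Ring
import HarnessLib

/-!
# Free actions: the orbit decomposition `X ≃ (X/K) × K`, and extension of a free action of a
# subgroup to a free action of a finite overgroup

Topic `Literature/GroupTheory/PermutationGroups`; Mathlib-only, theorems only.  Two elementary
facts about FREE actions (every point has trivial stabiliser) used in the finite-completion proof
that amalgamated free products of finite groups are residually finite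
(`Literature/GroupTheory/CombinatorialGroupTheory/FiniteAmalgamResiduallyFinite.lean`):

* `exists_equiv_prod_of_free` — a free `K`-set `X` is `K`-isomorphic to `Q × K` with `K` acting by
  left multiplication on the second factor, `Q = X/K` the orbit space ("a free `G`-set is a disjoint
  union of copies of the regular one");
* `exists_perm_hom_comp_eq_of_free` — **extension lemma**: if `ψ : K →* P` is injective, `P` is
  finite, `κ : K →* Perm Y` is a FREE action of `K` on a finite set `Y` and `|P|` divides `|Y|`,
  then `κ` is the restriction along `ψ` of some action `ρ : P →* Perm Y` (which may be taken free):
  `ρ ∘ ψ = κ`.  Proof: `Y ≅_K (Y/K) × K`, `P ≅_K (ψK\P) × K`, and `|Y/K| = (|Y|/|P|) · |ψK\P|`, so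
  `Y ≅_K S × P` for a set `S` with `|S| = |Y|/|P|`; transport the left regular action of `P`.

These are the two counting facts behind the classical statement that a finite amalgam
`A *_C B` of finite groups embeds its factors in a common finite permutation group
(B. H. Neumann's permutational products) — cf. D. E. Cohen, *Combinatorial Group Theory: a
topological approach*, LMS Student Texts 14 (1989), Ch. 1, proof of Prop. 22 and of Prop. 33
(finite completion of partial permutation actions).

## References

* D. E. Cohen, *Combinatorial Group Theory: a topological approach*, London Math. Soc. Student
  Texts 14, Cambridge Univ. Press (1989), §1.4–§1.5 (Props. 22, 33, Exercise 27). [CohenCGT1989]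
-/

namespace Literature.GroupTheory.PermutationGroups

open MulAction Function Equiv

universe u v w

section FreeProd

variable {K : Type u} {X : Type v} [Group K] [MulAction K X]

/-- For a FREE action of `K` on `X`, the map `(q, k) ↦ k • q.out` from `(X/K) × K` to `X` is a
bijection (every point is uniquely a translate of the chosen representative of its orbit).
[cite: CohenCGT1989, Ch. 1 proof of Prop. 22] -/
theorem bijective_smul_out (hfree : ∀ (k : K) (x : X), k • x = x → k = 1) :
    Function.Bijective (fun p : orbitRel.Quotient K X × K => p.2 • p.1.out) := by
  constructor
  · rintro ⟨q, k⟩ ⟨q', k'⟩ h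
    dsimp only at h
    have hq : q = q' := by
      rw [← Quotient.out_eq q, ← Quotient.out_eq q']
      refine Quotient.sound ?_
      change q.out ∈ orbit K q'.out
      refine ⟨k⁻¹ * k', ?_⟩
      change (k⁻¹ * k') • q'.out = q.out
      rw [mul_smul, ← h, inv_smul_smul]
    subst hq
    have h1 : (k'⁻¹ * k) • q.out = q.out := by rw [mul_smul, h, inv_smul_smul]
    have h2 : k'⁻¹ * k = 1 := hfree _ _ h1
    have h3 : k = k' := by
      have := congrArg (k' * ·) h2
      simpa [← mul_assoc] using this
    rw [h3]
  · intro x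
    let q : orbitRel.Quotient K X := Quotient.mk (orbitRel K X) x
    have hx : q.out ∈ orbit K x := Quotient.exact (Quotient.out_eq q)
    obtain ⟨k, hk⟩ := hx
    refine ⟨(q, k⁻¹), ?_⟩
    change k⁻¹ • q.out = x
    rw [← hk, inv_smul_smul]

/-- **Orbit decomposition of a free action.**  For a free action of `K` on `X` there is a bijection
`e : X ≃ (X/K) × K` under which the action becomes left multiplication on the second factor:
`e (k • x) = ((e x).1, k * (e x).2)`. [cite: CohenCGT1989, Ch. 1 proof of Prop. 22] -/
theorem exists_equiv_prod_of_free (hfree : ∀ (k : K) (x : X), k • x = x → k = 1) :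
    ∃ e : X ≃ orbitRel.Quotient K X × K, ∀ (k : K) (x : X), e (k • x) = ((e x).1, k * (e x).2) := by
  let g : orbitRel.Quotient K X × K → X := fun p => p.2 • p.1.out
  have hg : Function.Bijective g := bijective_smul_out hfree
  refine ⟨(Equiv.ofBijective g hg).symm, fun k x => ?_⟩
  obtain ⟨⟨q, k₀⟩, rfl⟩ := hg.2 x
  have h1 : (Equiv.ofBijective g hg).symm (g (q, k₀)) = (q, k₀) :=
    Equiv.ofBijective_symm_apply_apply g hg (q, k₀)
  have h2 : k • g (q, k₀) = g (q, k * k₀) := by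
    change k • (k₀ • q.out) = (k * k₀) • q.out
    rw [mul_smul]
  rw [h2, Equiv.ofBijective_symm_apply_apply g hg (q, k * k₀), h1]

end FreeProd

section Extension

variable {K : Type u} {P : Type v} [Group K] [Group P] {Y : Type w}

/-- Cardinality count for a free action: `|X| = |X/K| · |K|`.
[cite: CohenCGT1989, Ch. 1 proof of Prop. 22] -/
theorem card_eq_card_quotient_mul_of_free {X : Type w} [MulAction K X]
    (hfree : ∀ (k : K) (x : X), k • x = x → k = 1) :
    Nat.card X = Nat.card (orbitRel.Quotient K X) * Nat.card K := by
  obtain ⟨e, -⟩ := exists_equiv_prod_of_free hfree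
  rw [Nat.card_congr e, Nat.card_prod]

/-- **Extension lemma for free actions.**  Let `ψ : K →* P` be injective with `P` finite, and let
`κ : K →* Perm Y` be a FREE action of `K` on a finite set `Y` whose cardinality is divisible by
`|P|`.  Then there is an action `ρ : P →* Perm Y`, again free, whose restriction along `ψ` is `κ`:
`ρ (ψ k) = κ k` for all `k`.  (Decompose `Y ≅_K (Y/K) × K` and `P ≅_K (ψK\P) × K`; since
`|Y/K| = (|Y|/|P|)·|ψK\P|` one can regroup the `K`-orbits of `Y` into `|Y|/|P|` blocks each
`K`-isomorphic to `P`, and let `P` act on each block by left translation.)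
[cite: CohenCGT1989, Ch. 1 proof of Prop. 33] -/
theorem exists_perm_hom_comp_eq_of_free [Finite P] [Finite Y] (ψ : K →* P)
    (hψ : Function.Injective ψ) (κ : K →* Perm Y) (hκ : ∀ k : K, k ≠ 1 → ∀ y : Y, κ k y ≠ y)
    (hcard : Nat.card P ∣ Nat.card Y) :
    ∃ ρ : P →* Perm Y, ρ.comp ψ = κ ∧ ∀ p : P, p ≠ 1 → ∀ y : Y, ρ p y ≠ y := by
  classical
  -- `K` is finite (it embeds in `P`)
  haveI : Finite K := Finite.of_injective ψ hψ
  -- the two free `K`-sets: `Y` via `κ`, and `P` via left multiplication through `ψ`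
  let instY : MulAction K Y := MulAction.compHom Y κ
  let instP : MulAction K P := MulAction.compHom P ψ
  have hfreeY : ∀ (k : K) (y : Y), (haveI := instY; k • y) = y → k = 1 := by
    intro k y h
    by_contra hk
    exact hκ k hk y h
  have hfreeP : ∀ (k : K) (p : P), (haveI := instP; k • p) = p → k = 1 := by
    intro k p h
    change ψ k * p = p at h
    exact hψ (by simpa using h)
  obtain ⟨eY, heY⟩ := @exists_equiv_prod_of_free K Y _ instY hfreeY
  obtain ⟨eP, heP⟩ := @exists_equiv_prod_of_free K P _ instP hfreeP
  -- orbit spaces and the counting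
  let QY := @orbitRel.Quotient K Y _ instY
  let QP := @orbitRel.Quotient K P _ instP
  have hY : Nat.card Y = Nat.card QY * Nat.card K := by
    rw [Nat.card_congr eY, Nat.card_prod]
  have hP : Nat.card P = Nat.card QP * Nat.card K := by
    rw [Nat.card_congr eP, Nat.card_prod]
  obtain ⟨s, hs⟩ := hcard
  have hKpos : 0 < Nat.card K := Nat.card_pos
  have hQY : Nat.card QY = s * Nat.card QP := by
    have : Nat.card QY * Nat.card K = (s * Nat.card QP) * Nat.card K := by
      rw [← hY, hs, hP]; ring
    exact Nat.eq_of_mul_eq_mul_right hKpos this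
  haveI : Finite QY := by
    haveI := instY; exact Quotient.finite _
  haveI : Finite QP := by
    haveI := instP; exact Quotient.finite _
  -- a bijection `Y/K ≃ Fin s × (ψK\P)`
  have hβ : Nonempty (QY ≃ Fin s × QP) := by
    haveI := Fintype.ofFinite QY
    haveI := Fintype.ofFinite QP
    refine ⟨Fintype.equivOfCardEq ?_⟩
    rw [Fintype.card_prod, Fintype.card_fin, ← Nat.card_eq_fintype_card,
      ← Nat.card_eq_fintype_card, hQY]
  obtain ⟨β⟩ := hβ
  -- the `K`-equivariant bijection `f : Y ≃ Fin s × P`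
  let f : Y ≃ Fin s × P :=
    eY.trans <| (Equiv.prodCongr β (Equiv.refl K)).trans <|
      (Equiv.prodAssoc (Fin s) QP K).trans <| Equiv.prodCongr (Equiv.refl (Fin s)) eP.symm
  have hf : ∀ (k : K) (y : Y), f (κ k y) = ((f y).1, ψ k * (f y).2) := by
    intro k y
    have h1 : eY (κ k y) = ((eY y).1, k * (eY y).2) := heY k y
    obtain ⟨⟨qY, k₀⟩, hy⟩ : ∃ p, eY y = p := ⟨_, rfl⟩
    obtain ⟨⟨i, q⟩, hq⟩ : ∃ p, β qY = p := ⟨_, rfl⟩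
    rw [hy] at h1
    have hfy : f y = (i, eP.symm (q, k₀)) := by simp [f, hy, hq]
    have hfky : f (κ k y) = (i, eP.symm (q, k * k₀)) := by simp [f, h1, hq]
    rw [hfky, hfy]
    refine Prod.ext rfl ?_
    dsimp only
    have h2 : eP (ψ k * eP.symm (q, k₀)) = (q, k * k₀) := by
      have := heP k (eP.symm (q, k₀))
      change eP (ψ k * eP.symm (q, k₀)) = _ at this
      rw [this, Equiv.apply_symm_apply]
    rw [← h2, Equiv.symm_apply_apply]
  -- the action of `P` on `Fin s × P` by left translation on the second factor, transported to `Y`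
  let L : P →* Perm (Fin s × P) :=
    { toFun := fun p => Equiv.prodCongr (Equiv.refl (Fin s)) (Equiv.mulLeft p)
      map_one' := by ext ⟨i, x⟩ <;> simp
      map_mul' := fun p p' => by ext ⟨i, x⟩ <;> simp [mul_assoc] }
  let ρ : P →* Perm Y := (f.symm.permCongrHom.toMonoidHom).comp L
  have hρ : ∀ (p : P) (y : Y), ρ p y = f.symm ((f y).1, p * (f y).2) := by
    intro p y
    change f.symm (L p (f.symm.symm y)) = _
    rw [Equiv.symm_symm]
    rfl
  refine ⟨ρ, ?_, ?_⟩
  · ext k y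
    rw [MonoidHom.comp_apply, hρ, ← hf, Equiv.symm_apply_apply]
  · intro p hp y h
    rw [hρ] at h
    have h' := congrArg f h
    rw [Equiv.apply_symm_apply] at h'
    have h'' := congrArg Prod.snd h'
    dsimp only at h''
    exact hp (by simpa using h'')

end Extension

end Literature.GroupTheory.PermutationGroups
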